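import Summits.BirchSwinnertonDyer.BirchSwinnertonDyer.Theorems.PrintCFramTCubeGlobalDefectThree
import HarnessLib

/-!
# Route PrintCFram, regime T: NO `K`-RATIONAL POINT OF ORDER `9` on `y² = x³ + k` over `K = ℚ(√−3)`
# — the global defect `d₀ = #W(K)[3^∞]` is exactly `3` on T_cube and `1` elsewhere, class-wide
# (cell `bsd-print-cfram`, seat p4 g3; supports stmt-BirchSwinnertonDyer-20699)

HONEST FRAMING (cell `bsd-print-cfram`, run/shared/lean/pub/bsd-print-cfram/, D-0131 (2) print
tier; verbatim in every file of the seat): the cell works the partition leaf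
`CornerF ∧ p ramified in the CM field K` (LADDER-BSD row K7r = B13; W-ALL row 12r) in PARTITION
currency — a leaf or a cell counts only when its theorem is in the kernel BY NAME. Nothing is
closed here. Third file on ty3's PART H column `d₀ = #W(K)[3^∞]` (ty2's T package displays it):
p558062 gave `W(K)[3] ≠ 0 ⟺ T_cube` and `W(K)[3^∞] = 0` otherwise; p559950 gave `#W(K)[3] ≤ 3` when
`4k ∉ ℚ³`. THIS FILE removes the last per-class ingredient: over `K = ℚ(θ)`, `θ² = −3`, with
`4k ∉ ℚ³`, **`y² = x³ + k` has NO `K`-rational point of order `9`** (`nine_torsion_imp_three_torsion`: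
`9P = 0 ⟹ 3P = 0`), hence `W(K)[3^∞] = W(K)[3]` and `d₀ ∈ {1, 3}` exactly — `3` on T_cube, `1` on
N / V / T_split — for every `j = 0` class of the leaf at once (on T_cube classes `4k ∈ ℚ³` only for
the rank-`0` class 27a; off T_cube no cube hypothesis is needed, `W(K)[3] = 0` by p558062), matching
PART H's 178 + 741 rows as a THEOREM. The proof uses only the CM automorphism
`[ω] : (x, y) ↦ (ωx, y)` (`ω = (θ − 1)/2`, an admissible change of variables with `u = ω`, so an
automorphism of the point group by the tree's `VariableChange.pointEquiv`) and the chord identity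
`P + [ω]P + [ω²]P = O` (the three points lie on the horizontal line `Y = y(P)`): if `9P = O ≠ 3P`
then `R = [ω]P − P` is killed by `3` (as `[ω]` fixes `3P = (0, ±√k)`), is non-zero (else `x(P) = 0`
and `3P = O`), so `R = (0, ±√k)` is `[ω]`-fixed too, whence `[ω]²P = 2[ω]P − P` and the chord
identity gives `3[ω]P = O`. Theorems only; no definition; no named fact. beyond-print: NO.

References: `Theorems/PrintCFramTCubeGlobalDefect{,Three}.lean`; `Literature/…/VariableChangePoints.lean`;
[cite: SilvermanAEC2009, III.2.3 (group law) and III.10 (Aut E for j = 0)]; [cite: SilvermanAEC2009, Exercise 3.7].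
-/

set_option linter.dupNamespace false
set_option autoImplicit false

noncomputable section

open scoped Classical
open WeierstrassCurve Literature.NumberTheory.EllipticCurves
  Literature.NumberTheory.EllipticCurves.Rank1Residual
  Summit.BirchSwinnertonDyer.Rank1Residual Summit.BirchSwinnertonDyer.Rank1Residual.X12

namespace Summit.BirchSwinnertonDyer.BirchSwinnertonDyer.Theorems.PrintCFram.GlobalDefect

variable {F : Type*} [Field F] [CharZero F]

/-! ## §1 The CM automorphism `[ω] : (x, y) ↦ (ωx, y)` as a group automorphism -/

omit [CharZero F] in
/-- Transport of a point isomorphism along an EQUALITY of Weierstrass equations, keeping its values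
on affine points (turns `pointEquiv W C : W(F) ≃+ (C • W)(F)` into an automorphism of `W(F)` when
`C • W = W`). [folklore] -/
theorem exists_addEquiv_of_eq {W W' : WeierstrassCurve F} (e : W' = W)
    (φ : W.toAffine.Point ≃+ W'.toAffine.Point) :
    ∃ ψ : W.toAffine.Point ≃+ W.toAffine.Point,
      ∀ (x y : F) (h : W.toAffine.Nonsingular x y) (x' y' : F) (h' : W'.toAffine.Nonsingular x' y'),
        φ (.some x y h) = .some x' y' h' →
          ∃ h'' : W.toAffine.Nonsingular x' y', ψ (.some x y h) = .some x' y' h'' := by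
  subst e
  exact ⟨φ, fun x y h x' y' h' hφ => ⟨h', hφ⟩⟩

omit [CharZero F] in
/-- **The automorphism `[ω]` of `y² = x³ + k`.** For `ω ≠ 0` with `ω³ = 1` there is a group
automorphism `φ` of `E_k(F)` with `φ(x, y) = (ωx, y)` — the admissible change of variables
`(u, r, s, t) = (ω, 0, 0, 0)` maps `E_k` to itself (`u⁶ = 1`) and acts on points by
`x ↦ u⁻²x = ωx`, `y ↦ u⁻³y = y`. [cite: SilvermanAEC2009, III.10 and III.1 Table 3.1] -/
theorem exists_cm_automorphism (k : F) {ω : F} (hω0 : ω ≠ 0) (hω3 : ω ^ 3 = 1) :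
    ∃ φ : (mordellCurve k).toAffine.Point ≃+ (mordellCurve k).toAffine.Point,
      ∀ (x y : F) (h : (mordellCurve k).toAffine.Nonsingular x y),
        ∃ h' : (mordellCurve k).toAffine.Nonsingular (ω * x) y, φ (.some x y h) = .some (ω * x) y h' := by
  set C : VariableChange F := ⟨Units.mk0 ω hω0, 0, 0, 0⟩ with hCdef
  have hu : ((C.u⁻¹ : Fˣ) : F) = ω ^ 2 := by
    rw [Units.val_inv_eq_inv_val, hCdef, Units.val_mk0]
    have : ω * ω ^ 2 = 1 := by rw [← pow_succ']; exact hω3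
    exact inv_eq_of_mul_eq_one_right this
  have hω6 : (ω ^ 2) ^ 6 = 1 := by
    calc (ω ^ 2) ^ 6 = (ω ^ 3) ^ 4 := by ring
      _ = 1 := by rw [hω3, one_pow]
  have hω4 : (ω ^ 2) ^ 2 = ω := by
    calc (ω ^ 2) ^ 2 = ω ^ 3 * ω := by ring
      _ = ω := by rw [hω3, one_mul]
  have hω23 : (ω ^ 2) ^ 3 = 1 := by
    calc (ω ^ 2) ^ 3 = (ω ^ 3) ^ 2 := by ring
      _ = 1 := by rw [hω3, one_pow]
  have hC : C • mordellCurve k = mordellCurve k := by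
    ext
    · simp [mordellCurve, variableChange_a₁, hCdef]
    · simp [mordellCurve, variableChange_a₂, hCdef]
    · simp [mordellCurve, variableChange_a₃, hCdef]
    · simp [mordellCurve, variableChange_a₄, hCdef]
    · rw [variableChange_a₆, hu]
      simp [mordellCurve, hCdef, hω6]
  obtain ⟨ψ, hψ⟩ := exists_addEquiv_of_eq hC (VariableChange.pointEquiv (mordellCurve k) C)
  refine ⟨ψ, fun x y h => ?_⟩
  have hX : C.toX x = ω * x := by
    rw [VariableChange.toX_def, hu, hω4]; simp [hCdef]
  have hY : C.toY x y = y := by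
    rw [VariableChange.toY_def, hu, hω23]; simp [hCdef]
  have h' : (C • mordellCurve k).toAffine.Nonsingular (ω * x) y := by
    have := (VariableChange.nonsingular_iff (mordellCurve k) C x y).mpr h
    rwa [hX, hY] at this
  refine hψ x y h (ω * x) y h' ?_
  rw [VariableChange.pointEquiv_some]
  congr 1

/-! ## §2 No point of order `9` -/

/-- A primitive cube root of unity from `√−3`: `ω = (θ − 1)/2` has `ω² + ω + 1 = 0`. [folklore] -/
theorem omega_relation {θ : F} (hθ : θ ^ 2 = -3) :
    ((θ - 1) / 2) ^ 2 + (θ - 1) / 2 + 1 = 0 := by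
  field_simp
  linear_combination hθ

/-- **The chord identity `P + [ω]P + [ω]²P = O`** on `y² = x³ + k` (`ω² + ω + 1 = 0`, `x(P) ≠ 0`):
the three points `(x, y)`, `(ωx, y)`, `(ω²x, y)` lie on the line `Y = y`. Concretely
`(x, y) + (ωx, y) = (ω²x, −y)`. [cite: SilvermanAEC2009, III.2.3 (group law)] -/
theorem some_add_some_rot {k ω : F} (hω : ω ^ 2 + ω + 1 = 0) {x y : F} (hx : x ≠ 0)
    (h : (mordellCurve k).toAffine.Nonsingular x y)
    (h₁ : (mordellCurve k).toAffine.Nonsingular (ω * x) y)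
    (h₂ : (mordellCurve k).toAffine.Nonsingular (ω * (ω * x)) y) :
    (Affine.Point.some x y h : (mordellCurve k).toAffine.Point) + .some (ω * x) y h₁ =
      -.some (ω * (ω * x)) y h₂ := by
  have hω1 : ω ≠ 1 := by
    rintro rfl; norm_num at hω
  have hne : x ≠ ω * x := by
    intro h0
    have : (ω - 1) * x = 0 := by linear_combination -h0
    rcases mul_eq_zero.mp this with h1 | h1
    · exact hω1 (by linear_combination h1)
    · exact hx h1
  rw [Affine.Point.add_of_X_ne hne, Affine.Point.neg_some]
  have hslope : (mordellCurve k).toAffine.slope x (ω * x) y y = 0 := by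
    rw [Affine.slope_of_X_ne hne, sub_self, zero_div]
  congr 1
  · simp only [Affine.addX, hslope, mordellCurve_a₁, mordellCurve_a₂]
    linear_combination (-x) * hω
  · simp only [Affine.addY, Affine.negAddY, Affine.addX, hslope, Affine.negY, mordellCurve_a₁,
      mordellCurve_a₂, mordellCurve_a₃]
    ring

/-- **NO POINT OF ORDER `9` over `ℚ(√−3)`.** Let every element of `F` be `a + bθ` (`θ² = −3`), `k ∈ ℚ`,
`k ≠ 0`, `−4k ∉ ℚ³`. Then every `F`-rational point of `y² = x³ + k` killed by `9` is killed by `3`.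
(Proof in the module docstring: `[ω]` fixes the `3`-torsion points `(0, ±√k)`; `R = [ω]P − P` is a
non-zero `3`-torsion point, so `[ω]`-fixed; then `[ω]²P = 2[ω]P − P` and the chord identity gives
`3[ω]P = O`.) [cite: SilvermanAEC2009, Exercise 3.7 and III.10] -/
theorem nine_torsion_imp_three_torsion {θ : F} (hθ : θ ^ 2 = -3)
    (hF : ∀ z : F, ∃ a b : ℚ, z = a + b * θ) {k : ℚ} (hk : k ≠ 0)
    (hcube : ¬ ∃ c : ℚ, c ^ 3 = -4 * k)
    (P : (mordellCurve (k : F)).toAffine.Point) (h9 : (9 : ℕ) • P = 0) : (3 : ℕ) • P = 0 := by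
  -- the cube root of unity and the automorphism
  set ω : F := (θ - 1) / 2 with hωdef
  have hω : ω ^ 2 + ω + 1 = 0 := omega_relation hθ
  have hω3 : ω ^ 3 = 1 := by linear_combination (ω - 1) * hω
  have hω0 : ω ≠ 0 := by rintro h0; rw [h0] at hω; norm_num at hω
  have hω1 : ω ≠ 1 := by rintro h1; rw [h1] at hω; norm_num at hω
  have hk' : (k : F) ≠ 0 := by exact_mod_cast hk
  obtain ⟨φ, hφ⟩ := exists_cm_automorphism (k : F) hω0 hω3
  -- `φ` fixes the points with `x = 0`
  have hfix : ∀ (y₀ : F) (h₀ : (mordellCurve (k : F)).toAffine.Nonsingular 0 y₀),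
      φ (.some 0 y₀ h₀) = .some 0 y₀ h₀ := by
    intro y₀ h₀
    obtain ⟨h', hP⟩ := hφ 0 y₀ h₀
    rw [hP]
    congr 1
    exact mul_zero ω
  -- every non-zero `3`-torsion point has `x = 0`, hence is `φ`-fixed
  have hfix3 : ∀ R : (mordellCurve (k : F)).toAffine.Point, (3 : ℕ) • R = 0 → φ R = R := by
    intro R hR
    rcases R with _ | ⟨xr, yr, hr⟩
    · exact map_zero φ
    · obtain ⟨hx0, -⟩ := three_torsion_x_eq_zero hθ hF hcube hr hR
      subst hx0
      exact hfix yr hr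
  by_contra h3
  -- `Q = 3P` is a non-zero `3`-torsion point
  have hQ3 : (3 : ℕ) • ((3 : ℕ) • P) = 0 := by rw [← mul_nsmul', show 3 * 3 = 9 by norm_num]; exact h9
  -- `P` is affine with `x ≠ 0`
  rcases P with _ | ⟨x, y, hxy⟩
  · exact h3 (nsmul_zero 3)
  have heq : y ^ 2 = x ^ 3 + (k : F) := (mordellCurve_equation_iff _ x y).mp hxy.left
  have hx : x ≠ 0 := by
    intro hx0
    subst hx0
    have hy0 : y ≠ 0 := by
      rintro rfl
      apply hk'
      linear_combination -heq
    exact h3 (JZeroThree.mordellCurve_three_nsmul_eq_zero hxy hy0 (Or.inl rfl))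
  obtain ⟨h₁, hP₁⟩ := hφ x y hxy
  obtain ⟨h₂, hP₂⟩ := hφ (ω * x) y h₁
  -- `R = φ P − P` is `3`-torsion and non-zero, hence `φ`-fixed
  set P₀ : (mordellCurve (k : F)).toAffine.Point := .some x y hxy with hP₀
  have hR3 : (3 : ℕ) • (φ P₀ - P₀) = 0 := by
    rw [nsmul_sub, ← map_nsmul, hfix3 _ hQ3, sub_self]
  have hRfix : φ (φ P₀ - P₀) = φ P₀ - P₀ := hfix3 _ hR3
  -- the chord identity
  have hchord : P₀ + φ P₀ + φ (φ P₀) = 0 := by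
    rw [hP₀, hP₁, hP₂, some_add_some_rot hω hx hxy h₁ h₂, neg_add_cancel]
  -- combine: `φ (φ P₀) = 2 • φ P₀ − P₀`, so `3 • φ P₀ = 0`
  rw [map_sub] at hRfix
  have h3φ : (3 : ℕ) • φ P₀ = 0 := by
    have e1 : φ (φ P₀) = φ P₀ + φ P₀ - P₀ := by
      rw [sub_eq_iff_eq_add] at hRfix
      rw [hRfix]
      abel
    rw [e1] at hchord
    have : (3 : ℕ) • φ P₀ = P₀ + φ P₀ + (φ P₀ + φ P₀ - P₀) := by abel
    rw [this, hchord]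
  apply h3
  have : φ ((3 : ℕ) • P₀) = 0 := by rw [map_nsmul, h3φ]
  exact (map_eq_zero_iff φ φ.injective).mp this

section Frame

variable {K : Type} [Field K] [NumberField K]

/-- **`d₀ = #W(K)[3^∞] = #W(K)[3]` on a `3`-frame, class-wide.** `[K:ℚ] = 2`, `d_K = −3`, `W` any
model over `ℚ` of `y² = x³ + k` (`C • W = E_k`, `k ≠ 0`, `4k ∉ ℚ³`): every point of `W(K)` killed by
`9` is killed by `3`. With p558062 / p559950: `d₀ = 3` on T_cube frames and `d₀ = 1` on N, V,
T_split — ty3 PART H's column as a theorem. [cite: SilvermanAEC2009, Exercise 3.7 and III.10] -/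
theorem nine_torsion_frameField (hK2 : Module.finrank ℚ K = 2) (hdK : NumberField.discr K = -3)
    {W : WeierstrassCurve ℚ} {C : VariableChange ℚ} {k : ℚ} (hk : k ≠ 0)
    (hW : C • W = mordellCurve k) (hcube : ¬ ∃ c : ℚ, c ^ 3 = 4 * k)
    (Q : (W.baseChange K).toAffine.Point) (h9 : (9 : ℕ) • Q = 0) : (3 : ℕ) • Q = 0 := by
  obtain ⟨θ, hθ, hF⟩ := exists_generator_frameField hK2 hdK
  have hcube' : ¬ ∃ c : ℚ, c ^ 3 = -4 * k := fun h => hcube ((exists_cube_neg_iff k).mp h)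
  have hmodel : (mordellCurve k).baseChange K = (C.map (algebraMap ℚ K)) • W.baseChange K := by
    rw [← hW, baseChange, baseChange, map_variableChange]
  have hmk : (mordellCurve k).baseChange K = mordellCurve (k : K) := by
    rw [mordellCurve_baseChange]; rfl
  let e : (W.baseChange K).toAffine.Point ≃+ (mordellCurve (k : K)).toAffine.Point :=
    (VariableChange.pointEquiv (W.baseChange K) (C.map (algebraMap ℚ K))).trans
      (hmk ▸ hmodel ▸ AddEquiv.refl _)
  have h9e : (9 : ℕ) • e Q = 0 := by rw [← map_nsmul, h9, map_zero]
  have h3e := nine_torsion_imp_three_torsion hθ hF hk hcube' (e Q) h9e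
  rw [← map_nsmul] at h3e
  exact (map_eq_zero_iff e e.injective).mp h3e

end Frame

end Summit.BirchSwinnertonDyer.BirchSwinnertonDyer.Theorems.PrintCFram.GlobalDefect

end
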